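import Mathlib
import HarnessLib
import Summits.ResolutionOfSingularities.ResolutionOfSingularities.Theorems.WildQuotientsWildQuotientResolutionS1aQhSymChartRows
import Summits.ResolutionOfSingularities.ResolutionOfSingularities.Theorems.WildQuotientsWildQuotientResolutionS1aQhAbsCover

/-!
# S1a — R4c cusp, brick (b3-norms): the chart-level NORMS `N(x′₂)`, `N(x′₁)`, `N(h_O)` are `τ′`-FIXED (two moving generators)

[OURS · L1 W4.5c · lead-1 g17; plan-1 RULING R-F15v (2) ★ R4c `cusp_killsIn_two`, memo `Cruxes/CyclicQuotientFourfolds/Lines/s1a_logminvertex-R4c-PROGRESS.md` §2/§4: the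
member chart `U_O = [N(x₁)] ∩ D(N(x₂)) ∩ D(N(h_O))` inverts `q·b′` with `b′` built from the norms `N(x′₂) = ∏ₗ(x′₂ + l·x_none^sh x′₀)` and `N(h) = ∏ₗ h_l`,
`h_l = 2(x′₂ + l·c₂) − 3x_none(x′₁ + l·c₁)²`; the hypothesis `hq` of ✓`exists_principalCentreChartSec_of_memberAway` needs `τ′(q b′) = q b′`, i.e. these norms are `τ′`-fixed
(`τ′ = conj Φ σ_chart` on the pinned model; rows ✓`QhSym.qsc_row_one/_two`). Generic tool `prod_shift_fixed` (a `ZMod p`-indexed product whose factors are shifted by `τ`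
is fixed) and `natCast_val_add_one`] — NOT statements of the manuscript; counted 0; AI-level work, weaker than expert review. Crux stmt-ResolutionOfSingularities-17941
`CyclicQuotientFourfolds`, line `s1a-logminvertex` v13 (`stub_reachLowerInFX`).
-/

set_option linter.dupNamespace false

noncomputable section

open MvPolynomial
open Literature.AlgebraicGeometry.Resolution
open scoped LaurentPolynomial
open Summit.ResolutionOfSingularities.ResolutionOfSingularities.Theorems.WildQuotientResolution.S1
open Summit.ResolutionOfSingularities.ResolutionOfSingularities.Theorems.WildQuotientResolution.S1.CoarseChart
open Summit.ResolutionOfSingularities.ResolutionOfSingularities.Theorems.WildQuotientResolution.S1.ProducerStep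
open Summit.ResolutionOfSingularities.ResolutionOfSingularities.Theorems.WildQuotientResolution.S1.ReesBigrading
open Summit.ResolutionOfSingularities.ResolutionOfSingularities.Theorems.WildQuotientResolution.S1.NodeTransport
open Summit.ResolutionOfSingularities.ResolutionOfSingularities.Theorems.WildQuotientResolution.S1.CobordantTransport
open Summit.ResolutionOfSingularities.ResolutionOfSingularities.Theorems.WildQuotientResolution.S1.NodeAway
open Summit.ResolutionOfSingularities.ResolutionOfSingularities.Theorems.WildQuotientResolution.S1.CentreAway
open Summit.ResolutionOfSingularities.ResolutionOfSingularities.Theorems.WildQuotientResolution.S1.BlowupCharts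
open Summit.ResolutionOfSingularities.ResolutionOfSingularities.Theorems.WildQuotientResolution.S1.KillCert
open Summit.ResolutionOfSingularities.ResolutionOfSingularities.Theorems.WildQuotientResolution.S1.GameFrame.GModel

namespace Summit.ResolutionOfSingularities.ResolutionOfSingularities.Theorems.WildQuotientResolution.S1.KillCert.QhSym

variable {k : Type} [Field k] (σ : (MvPolynomial (Fin 4) k) ≃+* (MvPolynomial (Fin 4) k)) (hC : ∀ a : k, σ (C a) = C a)
  (h0 : σ (X 0) = X 0) (h1 : σ (X 1) = X 1 + X 0) (h2 : σ (X 2) = X 2 + X 0) (t₀ : (MvPolynomial (Fin 4) k)) (h3 : σ (X 3) = X 3 + t₀)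
  (w : Fin 3 → ℕ) (sh : ℕ) (hw1 : w 1 + sh ≤ w 0) (hw2 : w 0 = w 2 + sh) (hh : (MvPolynomial (Fin 4) k)) (hσh : σ hh = hh)
  {p : ℕ} (hp : 0 < p) (hσpL : ∀ y : (Localization.Away hh), (⇑(sigmaAway σ hσh))^[p] y = y)
  (hσJ : ∀ n : ℕ, ((weightedFiltration (fun i => algebraMap (MvPolynomial (Fin 4) k) (Localization.Away hh) (X ((![0, 1, 2] : Fin 3 → Fin 4) i))) w).ideal n).map ((sigmaAway σ hσh) : (Localization.Away hh) →+* (Localization.Away hh)) ≤ (weightedFiltration (fun i => algebraMap (MvPolynomial (Fin 4) k) (Localization.Away hh) (X ((![0, 1, 2] : Fin 3 → Fin 4) i))) w).ideal n)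
  {mg : ℕ} (mo : Fin mg → ℕ) (𝒜 : (Π j : Fin mg, ZMod (mo j)) → AddSubgroup (Localization.Away hh)) [GradedRing 𝒜]
  {dbar : ℕ} (y : ↥(𝒜 0)) (hy : y ∈ (traceFiltration 𝒜 (fun i => algebraMap (MvPolynomial (Fin 4) k) (Localization.Away hh) (X ((![0, 1, 2] : Fin 3 → Fin 4) i))) w).ideal dbar) (hσy : (sigmaAway σ hσh) (y : (Localization.Away hh)) = y)
  {P : Type} [CommRing P] [Algebra (MvPolynomial (Option (Fin 4)) k) P] (Φ : (ChartRing 𝒜 (fun i => algebraMap (MvPolynomial (Fin 4) k) (Localization.Away hh) (X ((![0, 1, 2] : Fin 3 → Fin 4) i))) w dbar y hy) ≃+* P)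
  (hΦa : ∀ a : (MvPolynomial (Fin 4) k), Φ ((algebraMap ↥(cobordantAlgebra (fun i => algebraMap (MvPolynomial (Fin 4) k) (Localization.Away hh) (X ((![0, 1, 2] : Fin 3 → Fin 4) i))) w) (ChartRing 𝒜 (fun i => algebraMap (MvPolynomial (Fin 4) k) (Localization.Away hh) (X ((![0, 1, 2] : Fin 3 → Fin 4) i))) w dbar y hy)) (algebraMap (Localization.Away hh) ↥(cobordantAlgebra (fun i => algebraMap (MvPolynomial (Fin 4) k) (Localization.Away hh) (X ((![0, 1, 2] : Fin 3 → Fin 4) i))) w) (algebraMap (MvPolynomial (Fin 4) k) (Localization.Away hh) a))) = (algebraMap (MvPolynomial (Option (Fin 4)) k) P) (cobordantAlgebra.subst k (![w 0, w 1, w 2, 0] : Fin 4 → ℕ) a))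
  (hΦs : Φ ((algebraMap ↥(cobordantAlgebra (fun i => algebraMap (MvPolynomial (Fin 4) k) (Localization.Away hh) (X ((![0, 1, 2] : Fin 3 → Fin 4) i))) w) (ChartRing 𝒜 (fun i => algebraMap (MvPolynomial (Fin 4) k) (Localization.Away hh) (X ((![0, 1, 2] : Fin 3 → Fin 4) i))) w dbar y hy)) (cobordantAlgebra.s (fun i => algebraMap (MvPolynomial (Fin 4) k) (Localization.Away hh) (X ((![0, 1, 2] : Fin 3 → Fin 4) i))) w)) = (algebraMap (MvPolynomial (Option (Fin 4)) k) P) (X none))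
  (hΦu : ∀ i : Fin 3, Φ ((algebraMap ↥(cobordantAlgebra (fun i => algebraMap (MvPolynomial (Fin 4) k) (Localization.Away hh) (X ((![0, 1, 2] : Fin 3 → Fin 4) i))) w) (ChartRing 𝒜 (fun i => algebraMap (MvPolynomial (Fin 4) k) (Localization.Away hh) (X ((![0, 1, 2] : Fin 3 → Fin 4) i))) w dbar y hy)) (cobordantAlgebra.u' (fun i => algebraMap (MvPolynomial (Fin 4) k) (Localization.Away hh) (X ((![0, 1, 2] : Fin 3 → Fin 4) i))) w i)) = (algebraMap (MvPolynomial (Option (Fin 4)) k) P) (X (some ((![0, 1, 2] : Fin 3 → Fin 4) i))))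


/-- In characteristic `p ≠ 1`: `((i + 1).val : P) = i.val + 1` for `i : ZMod p`. [folklore] -/
theorem natCast_val_add_one {P' : Type} [CommRing P'] {p' : ℕ} [NeZero p'] [CharP P' p'] (hp1 : p' ≠ 1) (i : ZMod p') :
    (((i + 1).val : ℕ) : P') = (i.val : P') + 1 := by
  rw [ZMod.val_add, ZMod.val_one'' hp1, ← CharP.cast_eq_mod P' p' (i.val + 1), Nat.cast_add, Nat.cast_one]

/-- **A `ZMod p`-indexed product whose factors are SHIFTED by `τ` is `τ`-fixed.** [folklore] -/
theorem prod_shift_fixed {P' : Type} [CommRing P'] {p' : ℕ} [NeZero p'] (τ : P' ≃+* P') (x : ZMod p' → P') (h : ∀ i, τ (x i) = x (i + 1)) :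
    τ (∏ i : ZMod p', x i) = ∏ i : ZMod p', x i := by
  rw [map_prod]
  simp_rw [h]
  exact Fintype.prod_equiv (Equiv.addRight 1) _ _ fun i => rfl

set_option maxHeartbeats 1600000 in
include h0 h1 h2 h3 hC hw2 hΦa hΦs hΦu in
/-- **`N(x′₂) = ∏ₗ (x′₂ + l·x_none^sh x′₀)` is `τ′`-fixed.** [OURS · L1 W4.5c · R4c] -/
theorem qsc_normX2_fixed [NeZero p] [CharP P p] (hp1 : p ≠ 1) :
    conj Φ (sigmaChart 𝒜 (fun i => algebraMap (MvPolynomial (Fin 4) k) (Localization.Away hh) (X ((![0, 1, 2] : Fin 3 → Fin 4) i))) w dbar y hy (sigmaAway σ hσh) hσJ hp hσpL hσy) ((algebraMap (MvPolynomial (Option (Fin 4)) k) P) (∏ i : ZMod p, (X (some 2) + (i.val : (MvPolynomial (Option (Fin 4)) k)) * (X none ^ sh * X (some 0))))) =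
      (algebraMap (MvPolynomial (Option (Fin 4)) k) P) (∏ i : ZMod p, (X (some 2) + (i.val : (MvPolynomial (Option (Fin 4)) k)) * (X none ^ sh * X (some 0)))) := by
  obtain ⟨rn, r0, -⟩ := qsc_rows_fixed σ hC h0 h1 h2 t₀ h3 w hh hσh hp hσpL hσJ mo 𝒜 y hy hσy Φ hΦa hΦs hΦu
  have r2 := qsc_row_two σ h0 h1 h2 t₀ h3 w sh hw2 hh hσh hp hσpL hσJ mo 𝒜 y hy hσy Φ hΦs hΦu
  rw [map_prod]
  refine prod_shift_fixed (conj Φ (sigmaChart 𝒜 (fun i => algebraMap (MvPolynomial (Fin 4) k) (Localization.Away hh) (X ((![0, 1, 2] : Fin 3 → Fin 4) i))) w dbar y hy (sigmaAway σ hσh) hσJ hp hσpL hσy)) _ fun i => ?_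
  simp only [map_add, map_mul, map_pow, map_natCast, r2, rn, r0, natCast_val_add_one hp1]
  ring

set_option maxHeartbeats 1600000 in
include h0 h1 h2 h3 hC hw1 hΦa hΦs hΦu in
/-- **`N(x′₁) = ∏ₗ (x′₁ + l·x_none^sh (x′₀ x_none^{w₀−w₁−sh}))` is `τ′`-fixed.** [OURS · L1 W4.5c · R4c] -/
theorem qsc_normX1_fixed [NeZero p] [CharP P p] (hp1 : p ≠ 1) :
    conj Φ (sigmaChart 𝒜 (fun i => algebraMap (MvPolynomial (Fin 4) k) (Localization.Away hh) (X ((![0, 1, 2] : Fin 3 → Fin 4) i))) w dbar y hy (sigmaAway σ hσh) hσJ hp hσpL hσy) ((algebraMap (MvPolynomial (Option (Fin 4)) k) P) (∏ i : ZMod p, (X (some 1) + (i.val : (MvPolynomial (Option (Fin 4)) k)) * (X none ^ sh * (X (some 0) * X none ^ (w 0 - (w 1 + sh))))))) =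
      (algebraMap (MvPolynomial (Option (Fin 4)) k) P) (∏ i : ZMod p, (X (some 1) + (i.val : (MvPolynomial (Option (Fin 4)) k)) * (X none ^ sh * (X (some 0) * X none ^ (w 0 - (w 1 + sh)))))) := by
  obtain ⟨rn, r0, -⟩ := qsc_rows_fixed σ hC h0 h1 h2 t₀ h3 w hh hσh hp hσpL hσJ mo 𝒜 y hy hσy Φ hΦa hΦs hΦu
  have r1 := qsc_row_one σ h0 h1 h2 t₀ h3 w sh hw1 hh hσh hp hσpL hσJ mo 𝒜 y hy hσy Φ hΦs hΦu
  rw [map_prod]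
  refine prod_shift_fixed (conj Φ (sigmaChart 𝒜 (fun i => algebraMap (MvPolynomial (Fin 4) k) (Localization.Away hh) (X ((![0, 1, 2] : Fin 3 → Fin 4) i))) w dbar y hy (sigmaAway σ hσh) hσJ hp hσpL hσy)) _ fun i => ?_
  simp only [map_add, map_mul, map_pow, map_natCast, r1, rn, r0, natCast_val_add_one hp1]
  ring

set_option maxHeartbeats 1600000 in
include h0 h1 h2 h3 hC hw1 hw2 hΦa hΦs hΦu in
/-- **`N(h) = ∏ₗ hₗ`, `hₗ = 2(x′₂ + l·c₂) − 3x_none(x′₁ + l·c₁)²`, is `τ′`-fixed** (`c₂ = x_none^sh x′₀`, `c₁ = x_none^sh x′₀ x_none^{w₀−w₁−sh}`; `h₀ = h_O = 2x′₂ − 3x_none x′₁²`,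
the member-row unit of the cusp). [OURS · L1 W4.5c · R4c] -/
theorem qsc_normH_fixed [NeZero p] [CharP P p] (hp1 : p ≠ 1) :
    conj Φ (sigmaChart 𝒜 (fun i => algebraMap (MvPolynomial (Fin 4) k) (Localization.Away hh) (X ((![0, 1, 2] : Fin 3 → Fin 4) i))) w dbar y hy (sigmaAway σ hσh) hσJ hp hσpL hσy) ((algebraMap (MvPolynomial (Option (Fin 4)) k) P) (∏ i : ZMod p, (2 * (X (some 2) + (i.val : (MvPolynomial (Option (Fin 4)) k)) * (X none ^ sh * X (some 0))) -
        3 * X none * (X (some 1) + (i.val : (MvPolynomial (Option (Fin 4)) k)) * (X none ^ sh * (X (some 0) * X none ^ (w 0 - (w 1 + sh))))) ^ 2))) =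
      (algebraMap (MvPolynomial (Option (Fin 4)) k) P) (∏ i : ZMod p, (2 * (X (some 2) + (i.val : (MvPolynomial (Option (Fin 4)) k)) * (X none ^ sh * X (some 0))) -
        3 * X none * (X (some 1) + (i.val : (MvPolynomial (Option (Fin 4)) k)) * (X none ^ sh * (X (some 0) * X none ^ (w 0 - (w 1 + sh))))) ^ 2)) := by
  obtain ⟨rn, r0, -⟩ := qsc_rows_fixed σ hC h0 h1 h2 t₀ h3 w hh hσh hp hσpL hσJ mo 𝒜 y hy hσy Φ hΦa hΦs hΦu
  have r1 := qsc_row_one σ h0 h1 h2 t₀ h3 w sh hw1 hh hσh hp hσpL hσJ mo 𝒜 y hy hσy Φ hΦs hΦu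
  have r2 := qsc_row_two σ h0 h1 h2 t₀ h3 w sh hw2 hh hσh hp hσpL hσJ mo 𝒜 y hy hσy Φ hΦs hΦu
  rw [map_prod]
  refine prod_shift_fixed (conj Φ (sigmaChart 𝒜 (fun i => algebraMap (MvPolynomial (Fin 4) k) (Localization.Away hh) (X ((![0, 1, 2] : Fin 3 → Fin 4) i))) w dbar y hy (sigmaAway σ hσh) hσJ hp hσpL hσy)) _ fun i => ?_
  simp only [map_sub, map_add, map_mul, map_pow, map_natCast, map_ofNat, r1, r2, rn, r0, natCast_val_add_one hp1]
  ring

end Summit.ResolutionOfSingularities.ResolutionOfSingularities.Theorems.WildQuotientResolution.S1.KillCert.QhSym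

end
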